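import Literature.NumberTheory.DiophantineGeometry.AbcStewartYu2001PlaceBoundsAnalysis
import Literature.Barriers.ABC.BakerMethodBoundsKummerPlaceBoundsThmTwoProofs
import Literature.NumberTheory.Transcendental.Waldschmidt1980HW2
import HarnessLib

/-!
# Stewart–Yu 2001, Theorem 2 from the two `p`-adic place bounds and the grouped Kummer archimedean bound

`Literature/NumberTheory/DiophantineGeometry/AbcStewartYu2001KummerPlaceBoundsProofs.lean` — proofs companion
(theorems only; no definition, no named fact) of `AbcStewartYu2001.lean`.  It PROVES the named fact
`stewartYu2001_thm2` (Stewart–Yu 2001, Theorem 2 [cite: StewartYu2001, Theorem 2]: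
`z < exp(p′ · G^{c log₃ G⋆ / log₂ G})`, `p′ = min{P(x), P(y), P(z)}`) from EXACTLY the hypotheses of the
Theorem-1 door `Literature.Barriers.ABC.BakerMethodBounds_of_placeBounds_kummerArchBound₂`
(`BakerMethodBoundsKummerPlaceBoundsRegimeTwoProofs.lean`) plus ONE growth hypothesis on the archimedean constants:

* (p ∣ a) `ν_p(a) log p < Θ_{bc} · (p / log p)(log p + Y)` and (p ∣ c, `ab > 1`)
  `ν_p(c) log p < Θ_{ab} · (p / log p)(log p + Y)` (`Θ_{uv} = K^{ω(uv)+1} ∏_{q ∣ uv} log q`, `K ≥ 1`,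
  `Y = log max{e, 2 log c}`) — `p`-adic bounds for rational PRIMES of Yu-2007 quality, the conclusions of the
  A1.M3 cruxes `Y07Odd` / `Y07Two` of the cell abc-stewartyu via `KummerThird.placeBound_a/c_of_y07At`;
* the `E = 2` Kummer-conditional archimedean lower bound `hW₂` for linear forms in `n + 1` logarithms of positive
  rationals, of the shape of Waldschmidt 1980, Prop. 3.8, with constants `Cw(n) ≥ 0` — DISCHARGED in the tree by
  `Literature.NumberTheory.Transcendental.Waldschmidt1980.waldschmidt1980_hW₂` with `Cw = w80Cw`, `w80Cw n = (2⁷⁰ n)ⁿ`;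
* the growth class `∃ c₀, ∀ n, Cw(n) ≤ (c₀ n)ⁿ` (satisfied by `w80Cw`): load-bearing, since the number of grouped
  large primes grows with `G`.

Main result: `StewartYu2001.stewartYu2001_thm2_of_placeBounds_kummerArchBound₂` (the body of the staged door statement
`Summit.ABC.StewartYu.ThmTwo.ThmTwoDoor` of the cell), and its corollary `StewartYu2001.stewartYu2001_thm2_of_placeBounds₂`:
Theorem 2 from the two `p`-adic place bounds ALONE (`Cw := w80Cw`, `hW₂ := waldschmidt1980_hW₂`).  So Theorem 2 holds in the tree as soon as the two Gen-3 `p`-adic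
cruxes close — with NO further transcendence input (design (γ) of the cell: lit g5 2026-08-26, plan g7 AFTER-THIRD §1).

## The deduction [cite: StewartYu2001, Theorem 2 (proof), as reconstructed] [cite: StewartYu1991, p. 229]

For a triple with `a ≤ b`, `c > 2`, `G = rad(abc) ≥ 6`, `ω = ω(abc)`, `M = K^{ω+1} ∏_{q ∣ abc} log max(4, q)`
(`≥` every `Θ`), `Λ = log G`, and a threshold `T ≥ 1`:
* if `p′ = P(c)`: `log c ≤ ω(c) Θ_{ab} · 3 P(c) Y` (all primes of `c` are `≤ P(c)`; `log_le_of_primes_le_placeBounds`);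
* if `p′ = P(b)`: `log c ≤ log 2 + log b ≤ log 2 + Θ_{ac} Y · 3 ∑_{p ∣ b} p` (`log_le_route_a₂_placeBounds`);
* if `p′ = P(a)`: `log c ≤ log 2 + log b ≤ log 2 + log a − log log(c/b)` (`log(c/b) ≤ a/b`), `log a` as before and
  `−log log(c/b)` by the GROUPED Kummer step `Literature.Barriers.ABC.neg_log_sub_log_le_kummer₂_placeBounds_grouped`
  (large primes `q > T` of `bc` as separate generators, the `T`-smooth part as one generator paid `p`-adically).
In all cases `log c ≤ p′ · 700 C(n+1) 2^{n+2} Λ^n (ω M T Λ)³ · Y²` with `T^n ≤ G` (`log_le_pmin_mul_grouped`).  With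
`T = G^{s}`, `s = log₃ G⋆ / log₂ G` (so `n ≤ log₂ G / log₃ G⋆`), the self-improvement `X ≤ A log² max(e, 2X) ⇒
X ≤ 16 A log²(2A)` (`le_sixteen_mul_log_sq_of_le`), `StewartYu2001.absorb` for `ω, M, log G` and
`(log₂ G)³ ≤ 27 log G` for the new factors `C(n+1) 2^{n+2} Λ^n`, everything is `≤ G^{C s}`.

## References

* [StewartYu2001] C. L. Stewart, K. Yu, *On the abc conjecture, II*, Duke Math. J. 108 (2001), 169–181 — Theorem 2
  (cite-only; typed from the secondaries in `AbcStewartYu2001.lean`).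
* [StewartYu1991] C. L. Stewart, K. Yu, *On the abc conjecture*, Math. Ann. 291 (1991), 225–230 — p. 229.
* [Waldschmidt1980] M. Waldschmidt, *A lower bound for linear forms in logarithms*, Acta Arith. 37 (1980), 257–283 —
  Prop. 3.8.
* [Gyory2008] K. Győry, Acta Arith. 133 (2008), 281–295 — p. 287 (3.12)–(3.13) (the absorption shape).
-/

noncomputable section

open Finset Real
open Literature.Barriers.ABC
open Literature.NumberTheory.DiophantineGeometry.Dioph
open Literature.NumberTheory.DiophantineGeometry.Pasten

namespace Literature.NumberTheory.DiophantineGeometry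

namespace StewartYu2001

/-! ### Elementary lemmas -/

/-- `Θ_{uv} = theta K u v 0 ≤ K^{ω(n)+1} ∏_{q ∣ n} log max(4, q)` whenever `uv ∣ n` (`u, v` coprime and non-zero,
`n ≠ 0`, `K ≥ 1`). [folklore] -/
private theorem theta_zero_le_M {K : ℝ} (hK : 1 ≤ K) {u v n : ℕ} (hu : u ≠ 0) (hv : v ≠ 0) (huv : u.Coprime v)
    (hn : n ≠ 0) (hdvd : u * v ∣ n) :
    theta K u v 0 ≤
      K ^ (n.primeFactors.card + 1) * ∏ q ∈ n.primeFactors, Real.log ((max 4 q : ℕ) : ℝ) := by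
  rw [theta_zero_eq K hu hv huv]
  have hsub : (u * v).primeFactors ⊆ n.primeFactors := Nat.primeFactors_mono hdvd hn
  have hK0 : 0 ≤ K := by linarith
  have h1 : K ^ ((u * v).primeFactors.card + 1) ≤ K ^ (n.primeFactors.card + 1) :=
    pow_le_pow_right₀ hK (by have := Finset.card_le_card hsub; omega)
  have hlog0 : ∀ q ∈ (u * v).primeFactors, 0 ≤ Real.log (q : ℝ) := fun q hq =>
    Real.log_nonneg (by exact_mod_cast (Nat.prime_of_mem_primeFactors hq).one_lt.le)
  have hpos4 : ∀ q : ℕ, 0 < Real.log ((max 4 q : ℕ) : ℝ) := fun q =>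
    Real.log_pos (by exact_mod_cast lt_of_lt_of_le (by norm_num : 1 < 4) (le_max_left 4 q))
  have hone4 : ∀ q : ℕ, 1 ≤ Real.log ((max 4 q : ℕ) : ℝ) := fun q => by
    rw [← Real.log_exp 1]
    apply Real.log_le_log (Real.exp_pos 1)
    have h4 : (4 : ℝ) ≤ ((max 4 q : ℕ) : ℝ) := by exact_mod_cast le_max_left 4 q
    have := Real.exp_one_lt_d9
    linarith
  have h2 : ∏ q ∈ (u * v).primeFactors, Real.log (q : ℝ) ≤
      ∏ q ∈ (u * v).primeFactors, Real.log ((max 4 q : ℕ) : ℝ) := by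
    apply Finset.prod_le_prod hlog0
    intro q hq
    have hq0 : (0 : ℝ) < q := by exact_mod_cast (Nat.prime_of_mem_primeFactors hq).pos
    exact Real.log_le_log hq0 (by exact_mod_cast le_max_right 4 q)
  have h3 : ∏ q ∈ (u * v).primeFactors, Real.log ((max 4 q : ℕ) : ℝ) ≤
      ∏ q ∈ n.primeFactors, Real.log ((max 4 q : ℕ) : ℝ) :=
    Finset.prod_le_prod_of_subset_of_one_le hsub (fun q _ => (hpos4 q).le) fun q _ _ => hone4 q
  exact mul_le_mul h1 (h2.trans h3) (Finset.prod_nonneg hlog0) (pow_nonneg hK0 _)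

/-- From a member bound `X ≤ Θ · Y · 3 ∑_{p ∣ u} p` with `Θ ≤ M`, `M, Y ≥ 0` and `u ∣ n ≠ 0`:
`X ≤ 3 (ω(n) M) P(u) Y` (`∑_{p ∣ u} p ≤ ω(u) P(u) ≤ ω(n) P(u)`). [folklore] -/
private theorem member_bound {Θ M Y X : ℝ} {u n : ℕ}
    (hX : X ≤ Θ * Y * (3 * ∑ p ∈ u.primeFactors, (p : ℝ)))
    (hΘM : Θ ≤ M) (hM : 0 ≤ M) (hY : 0 ≤ Y) (hn : n ≠ 0) (hun : u ∣ n) :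
    X ≤ 3 * ((n.primeFactors.card : ℝ) * M) * largestPrimeFactor u * Y := by
  have hsub : u.primeFactors ⊆ n.primeFactors := Nat.primeFactors_mono hun hn
  have hP0 : (0 : ℝ) ≤ largestPrimeFactor u := Nat.cast_nonneg _
  have hsum : ∑ p ∈ u.primeFactors, (p : ℝ) ≤ n.primeFactors.card * largestPrimeFactor u := by
    have h1 : ∑ p ∈ u.primeFactors, (p : ℝ) ≤ u.primeFactors.card • (largestPrimeFactor u : ℝ) :=
      Finset.sum_le_card_nsmul _ _ _ fun p hp => by
        exact_mod_cast le_largestPrimeFactor_of_mem_primeFactors hp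
    rw [nsmul_eq_mul] at h1
    have h2 : (u.primeFactors.card : ℝ) ≤ n.primeFactors.card := by
      exact_mod_cast Finset.card_le_card hsub
    exact h1.trans (mul_le_mul_of_nonneg_right h2 hP0)
  have hS0 : 0 ≤ ∑ p ∈ u.primeFactors, (p : ℝ) := Finset.sum_nonneg fun p _ => Nat.cast_nonneg p
  have hΘ : Θ * Y * (3 * ∑ p ∈ u.primeFactors, (p : ℝ)) ≤ M * Y * (3 * ∑ p ∈ u.primeFactors, (p : ℝ)) :=
    mul_le_mul_of_nonneg_right (mul_le_mul_of_nonneg_right hΘM hY) (by positivity)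
  calc X ≤ M * Y * (3 * ∑ p ∈ u.primeFactors, (p : ℝ)) := hX.trans hΘ
    _ ≤ M * Y * (3 * (n.primeFactors.card * largestPrimeFactor u)) :=
        mul_le_mul_of_nonneg_left (mul_le_mul_of_nonneg_left hsum (by norm_num)) (mul_nonneg hM hY)
    _ = 3 * ((n.primeFactors.card : ℝ) * M) * largestPrimeFactor u * Y := by ring

/-- `p′ = min{P(x), P(y), P(z)}` is symmetric in `x, y`. [cite: StewartYu2001, Theorem 2] -/
theorem pmin_swap (x y z : ℕ) : pmin y x z = pmin x y z := by
  rw [pmin_def, pmin_def, min_left_comm]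

/-- `p′` is one of `P(x)`, `P(y)`, `P(z)`. [folklore] -/
private theorem pmin_cases (x y z : ℕ) :
    pmin x y z = largestPrimeFactor x ∨ pmin x y z = largestPrimeFactor y ∨
      pmin x y z = largestPrimeFactor z := by
  rw [pmin_def]
  rcases min_choice (largestPrimeFactor x) (min (largestPrimeFactor y) (largestPrimeFactor z)) with h1 | h1
  · exact Or.inl h1
  · rw [h1]
    rcases min_choice (largestPrimeFactor y) (largestPrimeFactor z) with h2 | h2
    · exact Or.inr (Or.inl h2)
    · exact Or.inr (Or.inr h2)

/-! ### The per-triple deduction with the grouped Kummer step -/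

section PerTriple

variable {K : ℝ}

set_option maxHeartbeats 800000 in
/-- **The per-triple deduction (regimes by the member of least greatest prime factor).** For `K ≥ 1`, the two
`p`-adic place bounds, the `E = 2` Kummer-conditional archimedean binder with constants `Cw(n) ≥ 0` below a monotone
majorant `C(n) ≥ 1`, an abc triple with `a ≤ b`, `c > 2`, and a real `T ≥ 1`: there is `n` with `T^n ≤ G` and
`log c ≤ p′ · 700 C(n+1) 2^{n+2} Λ^n (ω M T Λ)³ · Y²` (`G = rad(abc)`, `Λ = max(1, log G)`, `ω = ω(abc)`,
`M = K^{ω+1} ∏_{q ∣ abc} log max(4, q)`, `Y = log max(e, 2 log c)`, `p′ = min P`).  Cases: `p′ = P(c)` — all primes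
of `c` are `≤ P(c)` (`log_le_of_primes_le_placeBounds`, `n = 0`); `p′ = P(b)` — `log c ≤ log 2 + log b` and the
`p`-adic bound for `b` (`log_le_route_a₂_placeBounds` on the swapped triple, `n = 0`); `p′ = P(a)` —
`log c ≤ log 2 + log a − log log(c/b)` (`log(c/b) ≤ a/b`), `log a` `p`-adically and `−log log(c/b)` by
`neg_log_sub_log_le_kummer₂_placeBounds_grouped` (or all primes of `c` `≤ T`, `n = 0`).
[cite: StewartYu2001, Theorem 2 (proof), as reconstructed] [cite: StewartYu1991, p. 229] -/
theorem log_le_pmin_mul_grouped (hK : 1 ≤ K)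
    (hpad : ∀ {a b c : ℕ}, IsABCTriple a b c → ∀ {p : ℕ}, p.Prime → p ∣ a →
      (a.factorization p : ℝ) * Real.log p < theta K b c 0 *
        ((p / Real.log p) * (Real.log p + Real.log (max (Real.exp 1) (2 * Real.log c)))))
    (hpadc : ∀ {a b c : ℕ}, IsABCTriple a b c → 1 < a * b → ∀ {p : ℕ}, p.Prime → p ∣ c →
      (c.factorization p : ℝ) * Real.log p < theta K a b 0 *
        ((p / Real.log p) * (Real.log p + Real.log (max (Real.exp 1) (2 * Real.log c)))))
    (Cw : ℕ → ℝ) (hCw : ∀ n, 0 ≤ Cw n)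
    (hW₂ : ∀ (n : ℕ) (α : Fin (n + 1) → ℚ) (b : Fin (n + 1) → ℤ) (V : Fin (n + 1) → ℝ) (W : ℝ),
      (∀ j, 0 < α j ∧ α j ≠ 1) →
      Module.finrank ℚ ↥(IntermediateField.adjoin ℚ
          (Set.range fun j => Real.sqrt (α j : ℝ))) = 2 ^ (n + 1) →
      Monotone V → 1 ≤ V 0 →
      (∀ j, max (Height.logHeight₁ (α j)) |Real.log (α j : ℝ)| ≤ V j) →
      0 < W → (∀ j, Height.logHeight₁ (b j : ℚ) ≤ W) →
      ∑ j, (b j : ℝ) * Real.log (α j : ℝ) ≠ 0 →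
      Real.exp (-(Cw (n + 1) * (∏ j, V j) * (W + Real.log (2 * V (Fin.last n))) *
          Real.log (2 * (if n = 0 then 1 else V ⟨n - 1, by omega⟩)) / Real.log 2 ^ (n + 2))) <
        |∑ j, (b j : ℝ) * Real.log (α j : ℝ)|)
    (Cb : ℕ → ℝ) (hCb1 : ∀ n, 1 ≤ Cb n) (hCbmono : Monotone Cb) (hCwCb : ∀ n, Cw n ≤ Cb n)
    {a b c : ℕ} (h : IsABCTriple a b c) (hab : a ≤ b) (hc2 : 2 < c) {T : ℝ} (hT : 1 ≤ T) :
    ∃ n : ℕ, T ^ n ≤ (rad a b c : ℝ) ∧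
      Real.log c ≤ (pmin a b c : ℝ) *
        (700 * Cb (n + 1) * 2 ^ (n + 2) * max 1 (Real.log (rad a b c : ℕ)) ^ n *
          (((a * b * c).primeFactors.card : ℝ) *
            (K ^ ((a * b * c).primeFactors.card + 1) *
              ∏ q ∈ (a * b * c).primeFactors, Real.log ((max 4 q : ℕ) : ℝ)) * T *
            max 1 (Real.log (rad a b c : ℕ))) ^ 3) *
        Real.log (max (Real.exp 1) (2 * Real.log c)) ^ 2 := by
  classical
  obtain ⟨ha, hb, habc, hcop⟩ := id h
  have hc0 : c ≠ 0 := by omega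
  have habc0 : a * b * c ≠ 0 := by positivity
  have hab1 : 1 < a * b := by
    by_contra hle
    push Not at hle
    have hab1 : a * b = 1 := by have := Nat.mul_pos ha hb; omega
    have ha1 := Nat.eq_one_of_mul_eq_one_right hab1
    have hb1 := Nat.eq_one_of_mul_eq_one_left hab1
    omega
  have hbc : b.Coprime c := coprime_right_of_isABCTriple h
  have hac : a.Coprime c := coprime_left_of_isABCTriple h
  have hK0 : 0 ≤ K := zero_le_one.trans hK
  have ha_r : (0 : ℝ) < a := by exact_mod_cast ha
  have hb_r : (0 : ℝ) < b := by exact_mod_cast hb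
  have hc_r : (0 : ℝ) < c := by exact_mod_cast Nat.pos_of_ne_zero hc0
  have hbc_lt : (b : ℝ) < c := by exact_mod_cast (show b < c by omega)
  have hT0 : 0 ≤ T := zero_le_one.trans hT
  -- notation
  set R : ℕ := rad a b c with hRdef
  have hR1 : (1 : ℝ) ≤ (R : ℝ) := one_le_rad_real a b c
  set Λ : ℝ := max 1 (Real.log (R : ℝ)) with hΛdef
  have hΛ1 : 1 ≤ Λ := le_max_left _ _
  have hΛ0 : 0 < Λ := by linarith
  set Y : ℝ := Real.log (max (Real.exp 1) (2 * Real.log c)) with hYdef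
  have hY1 : 1 ≤ Y := one_le_log_max_exp _
  have hY0 : 0 < Y := by linarith
  have hYY : Y ≤ Y ^ 2 := by
    have := mul_le_mul_of_nonneg_left hY1 hY0.le
    nlinarith only [this]
  set ω : ℕ := (a * b * c).primeFactors.card with hωdef
  set PL : ℝ := ∏ q ∈ (a * b * c).primeFactors, Real.log ((max 4 q : ℕ) : ℝ) with hPLdef
  set M : ℝ := K ^ (ω + 1) * PL with hMdef
  have hPL1 : 1 ≤ PL := one_le_prod_log_max_four _
  have hM1 : 1 ≤ M := one_le_mul_of_one_le_of_one_le (one_le_pow₀ hK) hPL1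
  have hM0 : 0 < M := by linarith
  have hω1 : (1 : ℝ) ≤ ω := by
    have h1' : 1 < a * b * c := lt_of_lt_of_le hab1 (Nat.le_mul_of_pos_right _ (Nat.pos_of_ne_zero hc0))
    exact_mod_cast Finset.card_pos.mpr (Nat.nonempty_primeFactors.mpr h1')
  have hω0 : (0 : ℝ) < ω := by linarith
  have hΘab : theta K a b 0 ≤ M := theta_zero_le_M hK ha.ne' hb.ne' hcop habc0 (Dvd.intro c rfl)
  have hΘac : theta K a c 0 ≤ M := theta_zero_le_M hK ha.ne' hc0 hac habc0 (Dvd.intro b (by ring))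
  have hΘbc : theta K b c 0 ≤ M := theta_zero_le_M hK hb.ne' hc0 hbc habc0 (Dvd.intro_left a (by ring))
  have hΘab0 : 0 ≤ theta K a b 0 := theta_nonneg hK0 a b 0
  set Q : ℝ := (ω : ℝ) * M * T * Λ with hQdef
  have hωM1 : 1 ≤ (ω : ℝ) * M := one_le_mul_of_one_le_of_one_le hω1 hM1
  have hωM0 : 0 ≤ (ω : ℝ) * M := zero_le_one.trans hωM1
  have hωMQ : (ω : ℝ) * M ≤ Q := by
    have : (ω : ℝ) * M = (ω : ℝ) * M * 1 * 1 := by ring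
    rw [this, hQdef]
    exact mul_le_mul (mul_le_mul_of_nonneg_left hT hωM0) hΛ1 zero_le_one
      (mul_nonneg hωM0 hT0)
  have hωMTQ : (ω : ℝ) * M * T ≤ Q := by
    have : (ω : ℝ) * M * T = (ω : ℝ) * M * T * 1 := by ring
    rw [this, hQdef]
    exact mul_le_mul_of_nonneg_left hΛ1 (mul_nonneg hωM0 hT0)
  have hQ1 : 1 ≤ Q := hωM1.trans hωMQ
  have hQ0 : 0 < Q := by linarith
  have hQQ3 : Q ≤ Q ^ 3 := le_self_pow₀ hQ1 (by norm_num)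
  -- `p′`
  have hp1 : (1 : ℝ) ≤ pmin a b c := by exact_mod_cast one_le_pmin a b c
  have hp0 : (0 : ℝ) ≤ pmin a b c := zero_le_one.trans hp1
  -- the three member bounds
  have hma : Real.log a ≤ 3 * ((ω : ℝ) * M) * largestPrimeFactor a * Y :=
    member_bound (log_le_route_a₂_placeBounds hK hpad h) hΘbc hM0.le hY0.le habc0
      (Dvd.intro (b * c) (by ring))
  have hmb : Real.log b ≤ 3 * ((ω : ℝ) * M) * largestPrimeFactor b * Y :=
    member_bound (log_le_route_a₂_placeBounds hK hpad h.swap) hΘac hM0.le hY0.le habc0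
      (Dvd.intro (a * c) (by ring))
  have hmc : Real.log c ≤ 3 * ((ω : ℝ) * M) * largestPrimeFactor c * Y := by
    have hτ : ∀ q ∈ c.primeFactors, (q : ℝ) ≤ (largestPrimeFactor c : ℝ) := fun q hq => by
      exact_mod_cast le_largestPrimeFactor_of_mem_primeFactors hq
    have h1 := log_le_of_primes_le_placeBounds hK hpadc h hab1 hτ
    have hcardc : (c.primeFactors.card : ℝ) ≤ ω := by
      exact_mod_cast Finset.card_le_card (Nat.primeFactors_mono (Dvd.intro_left (a * b) rfl) habc0)
    have hP0 : (0 : ℝ) ≤ largestPrimeFactor c := Nat.cast_nonneg _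
    calc Real.log c ≤ c.primeFactors.card * (theta K a b 0 * (3 * largestPrimeFactor c * Y)) := h1
      _ ≤ ω * (M * (3 * largestPrimeFactor c * Y)) := by
          apply mul_le_mul hcardc _ (by positivity) hω0.le
          exact mul_le_mul_of_nonneg_right hΘab (by positivity)
      _ = 3 * ((ω : ℝ) * M) * largestPrimeFactor c * Y := by ring
  -- `log c ≤ log 2 + log b`, `log 2 ≤ 1`
  have hlog2c : Real.log c ≤ Real.log 2 + Real.log b := by
    have h2b : (c : ℝ) ≤ 2 * b := by
      have : (c : ℝ) = a + b := by exact_mod_cast habc.symm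
      have hab_r : (a : ℝ) ≤ b := by exact_mod_cast hab
      linarith
    calc Real.log c ≤ Real.log (2 * b) := Real.log_le_log hc_r h2b
      _ = Real.log 2 + Real.log b := Real.log_mul (by norm_num) hb_r.ne'
  have hlog2 : Real.log 2 ≤ 1 := by have := Real.log_two_lt_d9; linarith
  -- closing with `n = 0` from a bound `log c ≤ p′ · 4Q · Y²`
  have hfin0 : Real.log c ≤ (pmin a b c : ℝ) * (4 * Q) * Y ^ 2 →
      ∃ n : ℕ, T ^ n ≤ (R : ℝ) ∧
        Real.log c ≤ (pmin a b c : ℝ) * (700 * Cb (n + 1) * 2 ^ (n + 2) * Λ ^ n * Q ^ 3) * Y ^ 2 := by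
    intro hB
    refine ⟨0, by rw [pow_zero]; exact hR1, ?_⟩
    have h4 : 4 * Q ≤ 700 * Cb (0 + 1) * 2 ^ (0 + 2) * Λ ^ 0 * Q ^ 3 := by
      rw [pow_zero, zero_add, zero_add, mul_one]
      have hC : (1 : ℝ) ≤ Cb 1 := hCb1 1
      have hQ3 : 0 ≤ Q ^ 3 := pow_nonneg hQ0.le 3
      calc 4 * Q ≤ 4 * Q ^ 3 := by linarith only [hQQ3]
        _ = 1 * 4 * Q ^ 3 := by ring
        _ ≤ (700 * Cb 1) * 2 ^ 2 * Q ^ 3 := by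
            apply mul_le_mul_of_nonneg_right _ hQ3
            apply mul_le_mul _ (by norm_num) (by norm_num) (by linarith)
            linarith
    calc Real.log c ≤ (pmin a b c : ℝ) * (4 * Q) * Y ^ 2 := hB
      _ ≤ (pmin a b c : ℝ) * (700 * Cb (0 + 1) * 2 ^ (0 + 2) * Λ ^ 0 * Q ^ 3) * Y ^ 2 :=
          mul_le_mul_of_nonneg_right (mul_le_mul_of_nonneg_left h4 hp0) (sq_nonneg _)
  -- a member bound `log c ≤ 1 + 3 (ωM) p′ Y` closes with `n = 0`
  have hmem : Real.log c ≤ 1 + 3 * ((ω : ℝ) * M) * (pmin a b c) * Y →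
      Real.log c ≤ (pmin a b c : ℝ) * (4 * Q) * Y ^ 2 := by
    intro hB
    have h1 : (1 : ℝ) ≤ (pmin a b c : ℝ) * Q * Y ^ 2 := by
      have := one_le_mul_of_one_le_of_one_le (one_le_mul_of_one_le_of_one_le hp1 hQ1) (hY1.trans hYY)
      simpa [mul_assoc] using this
    have h2 : 3 * ((ω : ℝ) * M) * (pmin a b c) * Y ≤ 3 * Q * (pmin a b c) * Y ^ 2 := by
      have := mul_le_mul (mul_le_mul_of_nonneg_left hωMQ (by norm_num : (0:ℝ) ≤ 3)) hYY hY0.le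
        (by positivity)
      -- `3 ωM · Y ≤ 3 Q · Y²`, times `p′`
      have hp := mul_le_mul_of_nonneg_left this hp0
      nlinarith only [hp]
    calc Real.log c ≤ 1 + 3 * ((ω : ℝ) * M) * (pmin a b c) * Y := hB
      _ ≤ (pmin a b c : ℝ) * Q * Y ^ 2 + 3 * Q * (pmin a b c) * Y ^ 2 := add_le_add h1 h2
      _ = (pmin a b c : ℝ) * (4 * Q) * Y ^ 2 := by ring
  -- restate the goal
  show ∃ n : ℕ, T ^ n ≤ (R : ℝ) ∧
    Real.log c ≤ (pmin a b c : ℝ) * (700 * Cb (n + 1) * 2 ^ (n + 2) * Λ ^ n * Q ^ 3) * Y ^ 2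
  rcases pmin_cases a b c with hpa | hpb | hpc
  · -- `p′ = P(a)`: the grouped Kummer step
    rcases neg_log_sub_log_le_kummer₂_placeBounds_grouped hK hpad hpadc Cw hCw hW₂ Cb hCb1 hCbmono hCwCb
        h hab1 hT with hsmall | ⟨n, hn1, hTn, hneg⟩
    · -- all primes of `c` are `≤ T`
      apply hfin0
      have h1 := log_le_of_primes_le_placeBounds hK hpadc h hab1 hsmall
      have hcardc : (c.primeFactors.card : ℝ) ≤ ω := by
        exact_mod_cast Finset.card_le_card (Nat.primeFactors_mono (Dvd.intro_left (a * b) rfl) habc0)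
      have h3 : Real.log c ≤ 3 * Q * Y := by
        calc Real.log c ≤ c.primeFactors.card * (theta K a b 0 * (3 * T * Y)) := h1
          _ ≤ ω * (M * (3 * T * Y)) := by
              apply mul_le_mul hcardc _ (by positivity) hω0.le
              exact mul_le_mul_of_nonneg_right hΘab (by positivity)
          _ = 3 * ((ω : ℝ) * M * T) * Y := by ring
          _ ≤ 3 * Q * Y := by
              apply mul_le_mul_of_nonneg_right _ hY0.le
              exact mul_le_mul_of_nonneg_left hωMTQ (by norm_num)
      have h4 : 3 * Q * Y ≤ (pmin a b c : ℝ) * (4 * Q) * Y ^ 2 := by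
        have hQY : 0 ≤ Q * Y ^ 2 := by positivity
        calc 3 * Q * Y ≤ 3 * Q * Y ^ 2 := mul_le_mul_of_nonneg_left hYY (by positivity)
          _ = 1 * (3 * (Q * Y ^ 2)) := by ring
          _ ≤ (pmin a b c : ℝ) * (4 * (Q * Y ^ 2)) :=
              mul_le_mul hp1 (mul_le_mul_of_nonneg_right (by norm_num) hQY) (by positivity) hp0
          _ = (pmin a b c : ℝ) * (4 * Q) * Y ^ 2 := by ring
      exact h3.trans h4
    · -- the archimedean case
      refine ⟨n, hTn, ?_⟩
      set Z : ℝ := Cb (n + 1) * 2 ^ (n + 2) * Λ ^ n * Q ^ 3 with hZdef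
      have hCb0 : 0 ≤ Cb (n + 1) := zero_le_one.trans (hCb1 _)
      have h2n : (8 : ℝ) ≤ 2 ^ (n + 2) := by
        calc (8 : ℝ) = 2 ^ 3 := by norm_num
          _ ≤ 2 ^ (n + 2) := pow_le_pow_right₀ (by norm_num) (by omega)
      have hΛn : 1 ≤ Λ ^ n := one_le_pow₀ hΛ1
      have hZ : 8 * Q ≤ Z := by
        rw [hZdef]
        calc 8 * Q = 1 * 8 * 1 * Q := by ring
          _ ≤ Cb (n + 1) * 2 ^ (n + 2) * Λ ^ n * Q ^ 3 :=
              mul_le_mul (mul_le_mul (mul_le_mul (hCb1 _) h2n (by norm_num) hCb0) hΛn zero_le_one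
                (mul_nonneg hCb0 (by positivity))) hQQ3 hQ0.le
                (mul_nonneg (mul_nonneg hCb0 (by positivity)) (by positivity))
      have hZ0 : 0 ≤ Z := le_trans (by positivity) hZ
      -- `−log Λ₀ ≤ 348 Z Y²`
      have hneg' : -Real.log (Real.log c - Real.log b) ≤ 348 * Z * Y ^ 2 := by
        have : 348 * Cb (n + 1) * 2 ^ (n + 2) * Λ ^ n * Q ^ 3 * Y ^ 2 = 348 * Z * Y ^ 2 := by
          rw [hZdef]; ring
        rw [← this]; exact hneg
      -- `log b ≤ log a − log Λ₀`
      set Λ₀ : ℝ := Real.log c - Real.log b with hΛ₀def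
      have hΛ₀pos : 0 < Λ₀ := by rw [hΛ₀def]; linarith only [Real.log_lt_log hb_r hbc_lt]
      have hΛ₀le : Λ₀ ≤ (a : ℝ) / b := by
        have h1' : Real.log ((c : ℝ) / b) ≤ (c : ℝ) / b - 1 := Real.log_le_sub_one_of_pos (by positivity)
        have h2 : (c : ℝ) / b - 1 = (a : ℝ) / b := by
          have : (c : ℝ) = a + b := by exact_mod_cast habc.symm
          rw [this, add_div, div_self hb_r.ne']; ring
        rw [hΛ₀def, ← Real.log_div hc_r.ne' hb_r.ne']
        linarith only [h1', h2]
      have hlogb : Real.log b ≤ Real.log a + (-Real.log Λ₀) := by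
        have : Real.log Λ₀ ≤ Real.log a - Real.log b := by
          rw [← Real.log_div ha_r.ne' hb_r.ne']
          exact Real.log_le_log hΛ₀pos hΛ₀le
        linarith only [this]
      -- assemble
      rw [hpa]
      have hPa1 : (1 : ℝ) ≤ largestPrimeFactor a := by exact_mod_cast one_le_largestPrimeFactor a
      have hPa0 : (0 : ℝ) ≤ largestPrimeFactor a := zero_le_one.trans hPa1
      have htot : Real.log c ≤ 1 + 3 * ((ω : ℝ) * M) * largestPrimeFactor a * Y + 348 * Z * Y ^ 2 := by
        linarith only [hlog2c, hlog2, hlogb, hma, hneg']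
      -- `1 + 3 ωM P Y ≤ 4 Q P Y² ≤ (Z/2) P Y²`, `348 Z Y² ≤ 348 Z P Y²`
      have h1 : 1 + 3 * ((ω : ℝ) * M) * largestPrimeFactor a * Y ≤
          (largestPrimeFactor a : ℝ) * (4 * Q) * Y ^ 2 := by
        have hA : (1 : ℝ) ≤ (largestPrimeFactor a : ℝ) * Q * Y ^ 2 := by
          have := one_le_mul_of_one_le_of_one_le (one_le_mul_of_one_le_of_one_le hPa1 hQ1) (hY1.trans hYY)
          simpa [mul_assoc] using this
        have hB : 3 * ((ω : ℝ) * M) * largestPrimeFactor a * Y ≤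
            3 * Q * largestPrimeFactor a * Y ^ 2 := by
          have := mul_le_mul (mul_le_mul_of_nonneg_left hωMQ (by norm_num : (0:ℝ) ≤ 3)) hYY hY0.le
            (by positivity)
          have hp := mul_le_mul_of_nonneg_left this hPa0
          nlinarith only [hp]
        calc 1 + 3 * ((ω : ℝ) * M) * largestPrimeFactor a * Y
            ≤ (largestPrimeFactor a : ℝ) * Q * Y ^ 2 + 3 * Q * largestPrimeFactor a * Y ^ 2 :=
              add_le_add hA hB
          _ = (largestPrimeFactor a : ℝ) * (4 * Q) * Y ^ 2 := by ring
      have h2 : 348 * Z * Y ^ 2 ≤ (largestPrimeFactor a : ℝ) * (348 * Z) * Y ^ 2 := by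
        have : 348 * Z * Y ^ 2 = 1 * (348 * Z) * Y ^ 2 := by ring
        rw [this]
        exact mul_le_mul_of_nonneg_right (mul_le_mul_of_nonneg_right hPa1 (by positivity)) (sq_nonneg _)
      have h3 : (largestPrimeFactor a : ℝ) * (4 * Q) * Y ^ 2 + (largestPrimeFactor a : ℝ) * (348 * Z) * Y ^ 2 ≤
          (largestPrimeFactor a : ℝ) * (700 * Z) * Y ^ 2 := by
        have h4Q : 4 * Q ≤ Z := by linarith only [hZ, hQ0]
        have : (largestPrimeFactor a : ℝ) * (4 * Q) * Y ^ 2 ≤ (largestPrimeFactor a : ℝ) * Z * Y ^ 2 :=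
          mul_le_mul_of_nonneg_right (mul_le_mul_of_nonneg_left h4Q hPa0) (sq_nonneg _)
        have hZY : 0 ≤ (largestPrimeFactor a : ℝ) * Z * Y ^ 2 := by positivity
        nlinarith only [this, hZY]
      have hfinal : (largestPrimeFactor a : ℝ) * (700 * Z) * Y ^ 2 =
          (largestPrimeFactor a : ℝ) * (700 * Cb (n + 1) * 2 ^ (n + 2) * Λ ^ n * Q ^ 3) * Y ^ 2 := by
        rw [hZdef]; ring
      linarith only [htot, h1, h2, h3, hfinal.le]
  · -- `p′ = P(b)`
    apply hfin0
    apply hmem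
    rw [hpb]
    linarith only [hlog2c, hlog2, hmb]
  · -- `p′ = P(c)`
    apply hfin0
    apply hmem
    rw [hpc]
    linarith only [hmc]

end PerTriple

/-! ### Self-improvement with a squared logarithm -/

/-- If `X ≤ A · (log max(e, 2X))²` with `A ≥ 1`, then `X ≤ 16 A (log 2A)²`: with `Y = log 2X > 1`,
`Y ≤ log 2A + 2 log Y` and `log Y ≤ 3Y/8` force `Y ≤ 4 log 2A`. [folklore] -/
private theorem le_sixteen_mul_log_sq_of_le {A X : ℝ} (hA : 1 ≤ A)
    (h : X ≤ A * Real.log (max (Real.exp 1) (2 * X)) ^ 2) :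
    X ≤ 16 * A * Real.log (2 * A) ^ 2 := by
  have hA0 : 0 < A := by linarith
  have hlog2A : Real.log 2 ≤ Real.log (2 * A) := Real.log_le_log two_pos (by linarith)
  have hl2 : (0.69 : ℝ) < Real.log 2 := by have := Real.log_two_gt_d9; linarith
  have hL0 : 0 < Real.log (2 * A) := by linarith
  rcases le_or_gt (2 * X) (Real.exp 1) with hsmall | hbig
  · rw [max_eq_left hsmall, Real.log_exp, one_pow, mul_one] at h
    have h1 : (0.69 : ℝ) ^ 2 ≤ Real.log (2 * A) ^ 2 :=
      pow_le_pow_left₀ (by norm_num) (hl2.le.trans hlog2A) 2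
    have h2 := mul_le_mul_of_nonneg_left h1 hA0.le
    nlinarith only [h, h2, hA0]
  · rw [max_eq_right hbig.le] at h
    have hX0 : 0 < 2 * X := lt_trans (Real.exp_pos 1) hbig
    set Y : ℝ := Real.log (2 * X) with hYdef
    have hY1 : 1 < Y := by rw [hYdef, Real.lt_log_iff_exp_lt hX0]; exact hbig
    have hY0 : 0 < Y := by linarith
    -- `log Y ≤ 3Y/8` (`8/3 ≤ e`)
    have hlogY : Real.log Y ≤ 3 * Y / 8 := by
      have h83 : Real.log (8 / 3) ≤ 1 := by
        rw [Real.log_le_iff_le_exp (by norm_num)]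
        have := Real.exp_one_gt_d9
        linarith
      have hY38 : 0 < 3 * Y / 8 := by linarith only [hY0]
      have h1 : Real.log Y = Real.log (8 / 3) + Real.log (3 * Y / 8) := by
        rw [← Real.log_mul (by norm_num) hY38.ne']
        congr 1
        ring
      have h2 : Real.log (3 * Y / 8) ≤ 3 * Y / 8 - 1 := Real.log_le_sub_one_of_pos hY38
      linarith only [h1, h2, h83]
    -- `Y ≤ log 2A + 2 log Y`
    have hYle : Y ≤ Real.log (2 * A) + 2 * Real.log Y := by
      have h2 : 2 * X ≤ 2 * A * Y ^ 2 := by linarith only [h]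
      have h3 : Y ≤ Real.log (2 * A * Y ^ 2) := by
        rw [hYdef]; exact Real.log_le_log hX0 h2
      rw [Real.log_mul (mul_pos two_pos hA0).ne' (pow_pos hY0 2).ne', Real.log_pow] at h3
      push_cast at h3
      linarith only [h3]
    have hY4 : Y ≤ 4 * Real.log (2 * A) := by linarith only [hYle, hlogY, hL0]
    have hYsq : Y ^ 2 ≤ (4 * Real.log (2 * A)) ^ 2 := pow_le_pow_left₀ hY0.le hY4 2
    calc X ≤ A * Y ^ 2 := h
      _ ≤ A * (4 * Real.log (2 * A)) ^ 2 := mul_le_mul_of_nonneg_left hYsq hA0.le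
      _ = 16 * A * Real.log (2 * A) ^ 2 := by ring

/-! ### `log₃ G⋆ ≤ log₂ G` -/

/-- `log₃ G⋆ ≤ log₂ G` for `G ≥ 6` (`G⋆ = max(G, 16)`): for `G ≥ 16` this is `log x ≤ x − 1` with `x = log₂ G`;
for `6 ≤ G < 16`, `log₃ 16 ≤ log₂ 6` since `log 16 ≤ 6`. Hence `thm2Exponent 1 G ≤ 1`. [folklore] -/
private theorem log₃_le_log₂ {G : ℝ} (hG : 6 ≤ G) :
    Real.log (Real.log (Real.log (max G 16))) ≤ Real.log (Real.log G) := by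
  have hG0 : 0 < G := by linarith
  have he3 : Real.exp 1 < 3 := by have := Real.exp_one_lt_d9; linarith
  have hlogG1 : 1 < Real.log G := by rw [Real.lt_log_iff_exp_lt hG0]; linarith
  have hllG : 0 < Real.log (Real.log G) := Real.log_pos hlogG1
  rcases le_or_gt 16 G with h16 | h16
  · rw [max_eq_left h16]
    have := Real.log_le_sub_one_of_pos hllG
    linarith
  · rw [max_eq_right h16.le]
    have hlog16 : 0 < Real.log 16 := Real.log_pos (by norm_num)
    have hlog16_1 : 1 < Real.log 16 := by
      rw [Real.lt_log_iff_exp_lt (by norm_num)]; linarith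
    have hll16 : 0 < Real.log (Real.log 16) := Real.log_pos hlog16_1
    have h6 : Real.log 16 ≤ 6 := by
      rw [Real.log_le_iff_le_exp (by norm_num)]
      have h1 : Real.exp 6 = Real.exp 1 ^ 6 := by rw [← Real.exp_nat_mul]; norm_num
      have h2 : (2 : ℝ) < Real.exp 1 := by have := Real.exp_one_gt_d9; linarith
      have h3 : (2 : ℝ) ^ 6 < Real.exp 1 ^ 6 := pow_lt_pow_left₀ h2 (by norm_num) (by norm_num)
      rw [h1]; linarith only [h3]
    have hlog6 : 0 < Real.log 6 := Real.log_pos (by norm_num)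
    calc Real.log (Real.log (Real.log 16)) ≤ Real.log (Real.log 6) :=
          Real.log_le_log hll16 (Real.log_le_log hlog16 h6)
      _ ≤ Real.log (Real.log G) :=
          Real.log_le_log hlog6 (Real.log_le_log (by norm_num) hG)

/-! ### The door: Theorem 2 from the two `p`-adic place bounds and the grouped Kummer archimedean bound -/

section Door

variable {K : ℝ}

set_option maxHeartbeats 1600000 in
/-- **Stewart–Yu 2001, Theorem 2, from the two `p`-adic place bounds and the `E = 2` Kummer-conditional archimedean
bound of Waldschmidt shape with constants of class `(c₀ n)ⁿ`.**  Suppose that for some `K ≥ 1` and every abc triple: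
(p ∣ a) `ν_p(a) log p < Θ_{bc} (p/log p)(log p + Y)`; (p ∣ c, `ab > 1`) `ν_p(c) log p < Θ_{ab} (p/log p)(log p + Y)`;
and that linear forms in `n + 1` logarithms of positive rationals `≠ 1` generating a `2`-Kummer extension of degree
`2^{n+1}` admit the lower bound `hW₂` (Waldschmidt 1980, Prop. 3.8 shape at `E = 2`) with constants
`0 ≤ Cw(n) ≤ (c₀ n)ⁿ`.  Then `stewartYu2001_thm2`: `z < exp(p′ · G^{C log₃ G⋆ / log₂ G})` for all coprime positive
`x + y = z` with `z > 2`.  These are EXACTLY the binders of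
`Literature.Barriers.ABC.BakerMethodBounds_of_placeBounds_kummerArchBound₂` (Theorem 1) plus the growth hypothesis —
discharged in the cell abc-stewartyu by the A1.M3 crux texts `Y07Odd`/`Y07Two` (`KummerThird.placeBound_a/c_of_y07At`)
and `Waldschmidt1980.waldschmidt1980_hW₂` (`w80Cw n = (2⁷⁰ n)ⁿ`, `w80Cw_le`).
Proof: w.l.o.g. `x ≤ y`; `T := exp E`, `E = log G · log₃ G⋆ / log₂ G` (`T = G^{s(G)}`); `log_le_pmin_mul_grouped`
with the majorant `C(n) = (max(1,|c₀|) n)ⁿ`; `n E ≤ log G` so `n ≤ log₂ G / log₃ G⋆`; `le_sixteen_mul_log_sq_of_le`;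
then every factor is `≤ exp(κ E)`: `ω, M, log G` by `StewartYu2001.absorb`, and `C(n+1) 2^{n+2} (log G)^n` by
`(log₂ G)³ ≤ 27 log G`, `(log₂ G)² ≤ 4 log G`, `log₃ G⋆ ≥ log₃ 16 > 0`, `log₃ G⋆ ≤ log₂ G`.
[cite: StewartYu2001, Theorem 2] [cite: StewartYu1991, p. 229] [cite: Waldschmidt1980, Prop 3.8 (p. 274)]
[cite: Gyory2008, p. 287 (3.12)–(3.13)] -/
theorem stewartYu2001_thm2_of_placeBounds_kummerArchBound₂ (hK : 1 ≤ K)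
    (hpad : ∀ {a b c : ℕ}, IsABCTriple a b c → ∀ {p : ℕ}, p.Prime → p ∣ a →
      (a.factorization p : ℝ) * Real.log p < theta K b c 0 *
        ((p / Real.log p) * (Real.log p + Real.log (max (Real.exp 1) (2 * Real.log c)))))
    (hpadc : ∀ {a b c : ℕ}, IsABCTriple a b c → 1 < a * b → ∀ {p : ℕ}, p.Prime → p ∣ c →
      (c.factorization p : ℝ) * Real.log p < theta K a b 0 *
        ((p / Real.log p) * (Real.log p + Real.log (max (Real.exp 1) (2 * Real.log c)))))
    (Cw : ℕ → ℝ) (hCw : ∀ n, 0 ≤ Cw n) (hgrowth : ∃ c₀ : ℝ, ∀ n, Cw n ≤ (c₀ * n) ^ n)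
    (hW₂ : ∀ (n : ℕ) (α : Fin (n + 1) → ℚ) (b : Fin (n + 1) → ℤ) (V : Fin (n + 1) → ℝ) (W : ℝ),
      (∀ j, 0 < α j ∧ α j ≠ 1) →
      Module.finrank ℚ ↥(IntermediateField.adjoin ℚ
          (Set.range fun j => Real.sqrt (α j : ℝ))) = 2 ^ (n + 1) →
      Monotone V → 1 ≤ V 0 →
      (∀ j, max (Height.logHeight₁ (α j)) |Real.log (α j : ℝ)| ≤ V j) →
      0 < W → (∀ j, Height.logHeight₁ (b j : ℚ) ≤ W) →
      ∑ j, (b j : ℝ) * Real.log (α j : ℝ) ≠ 0 →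
      Real.exp (-(Cw (n + 1) * (∏ j, V j) * (W + Real.log (2 * V (Fin.last n))) *
          Real.log (2 * (if n = 0 then 1 else V ⟨n - 1, by omega⟩)) / Real.log 2 ^ (n + 2))) <
        |∑ j, (b j : ℝ) * Real.log (α j : ℝ)|) :
    stewartYu2001_thm2 := by
  classical
  -- the majorant `C(n) = (c₁ n)ⁿ`, `c₁ = max(1, |c₀|)`
  obtain ⟨c₀, hc₀⟩ := hgrowth
  set c₁ : ℝ := max 1 |c₀| with hc₁def
  have hc₁1 : 1 ≤ c₁ := le_max_left _ _
  have hc₁0 : 0 ≤ c₁ := zero_le_one.trans hc₁1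
  set Cb : ℕ → ℝ := fun n => (c₁ * n) ^ n with hCbdef
  have hCb1 : ∀ n, 1 ≤ Cb n := by
    intro n
    rcases Nat.eq_zero_or_pos n with rfl | hn
    · simp [hCbdef]
    · have h1 : (1 : ℝ) ≤ c₁ * n := by
        have : (1 : ℝ) ≤ n := by exact_mod_cast hn
        nlinarith
      exact one_le_pow₀ h1
  have hCbmono : Monotone Cb := by
    refine monotone_nat_of_le_succ fun n => ?_
    have hn1 : (1 : ℝ) ≤ c₁ * (n + 1 : ℕ) := by
      have : (1 : ℝ) ≤ (n + 1 : ℕ) := by exact_mod_cast Nat.succ_pos n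
      nlinarith
    calc Cb n = (c₁ * n) ^ n := rfl
      _ ≤ (c₁ * (n + 1 : ℕ)) ^ n := by
          apply pow_le_pow_left₀ (by positivity)
          exact mul_le_mul_of_nonneg_left (by exact_mod_cast Nat.le_succ n) hc₁0
      _ ≤ (c₁ * (n + 1 : ℕ)) ^ (n + 1) := pow_le_pow_right₀ hn1 (Nat.le_succ n)
  have hCwCb : ∀ n, Cw n ≤ Cb n := by
    intro n
    calc Cw n ≤ (c₀ * n) ^ n := hc₀ n
      _ ≤ |(c₀ * n) ^ n| := le_abs_self _
      _ = (|c₀| * n) ^ n := by rw [abs_pow, abs_mul, Nat.abs_cast]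
      _ ≤ (c₁ * n) ^ n :=
          pow_le_pow_left₀ (by positivity)
            (mul_le_mul_of_nonneg_right (le_max_right _ _) (Nat.cast_nonneg n)) n
  -- the absorption constant for `ω`, `M`, `log G`
  obtain ⟨Cabs, hCabs0, habs⟩ := absorb hK
  -- constants
  set ℓ₀ : ℝ := Real.log (Real.log (Real.log 16)) with hℓ₀def
  have hℓ₀ : 0 < ℓ₀ := log_log_log_pos le_rfl
  set κ₁ : ℝ := 4 / ℓ₀ with hκ₁
  set κ₂ : ℝ := 27 / ℓ₀ ^ 2 with hκ₂
  set κ₃ : ℝ := 27 / ℓ₀ ^ 3 with hκ₃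
  set CA : ℝ := 7 / ℓ₀ + (4 * c₁ + 3) * κ₃ + κ₂ + 9 * Cabs + 3 with hCAdef
  have hCA0 : 0 ≤ CA := by positivity
  set Ctot : ℝ := 16 * (2 + CA) ^ 2 / ℓ₀ + CA + 2 * κ₁ with hCtotdef
  have hCtot0 : 0 ≤ Ctot := by positivity
  rw [stewartYu2001_thm2_iff]
  refine ⟨Ctot + 1, by positivity, ?_⟩
  -- w.l.o.g. `x ≤ y`
  suffices key : ∀ x y z : ℕ, IsABCTriple x y z → x ≤ y → 2 < z →
      Real.log z < pmin x y z * (rad x y z : ℝ) ^ thm2Exponent (Ctot + 1) (rad x y z) by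
    intro x y z h hz
    have hz0 : (0 : ℝ) < z := by exact_mod_cast lt_trans two_pos hz
    rw [← Real.log_lt_iff_lt_exp hz0]
    rcases le_total x y with hxy | hyx
    · exact key x y z h hxy hz
    · have := key y x z h.swap hyx hz
      rwa [pmin_swap, rad_swap] at this
  intro a b c h hab hc2
  obtain ⟨ha, hb, habc, hcop⟩ := id h
  have hc0 : c ≠ 0 := by omega
  have habc0 : a * b * c ≠ 0 := by positivity
  -- `G ≥ 6`, `L = log G > 1`, `u = log₂ G > 0`, `ℓ = log₃ G⋆ ∈ [ℓ₀, u]`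
  have hG6 : (6 : ℝ) ≤ (rad a b c : ℝ) := by exact_mod_cast six_le_rad h hc2
  have hG0 : (0 : ℝ) < (rad a b c : ℝ) := by linarith
  set L : ℝ := Real.log (rad a b c : ℝ) with hLdef
  have he3 : Real.exp 1 < 3 := by have := Real.exp_one_lt_d9; linarith
  have hL1 : 1 < L := by rw [hLdef, Real.lt_log_iff_exp_lt hG0]; linarith
  have hL0 : 0 < L := by linarith
  set u : ℝ := Real.log L with hudef
  have hu0 : 0 < u := Real.log_pos hL1
  have huL : u ≤ L - 1 := Real.log_le_sub_one_of_pos hL0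
  set ℓ : ℝ := Real.log (Real.log (Real.log (max (rad a b c : ℝ) 16))) with hℓdef
  have hℓℓ₀ : ℓ₀ ≤ ℓ := by
    have h16 : (16 : ℝ) ≤ max (rad a b c : ℝ) 16 := le_max_right _ _
    have hlog16 : 1 < Real.log 16 := by
      rw [Real.lt_log_iff_exp_lt (by norm_num)]; linarith
    have hll16 : 0 < Real.log (Real.log 16) := Real.log_pos hlog16
    have h1 : Real.log 16 ≤ Real.log (max (rad a b c : ℝ) 16) := Real.log_le_log (by norm_num) h16
    have h2 : Real.log (Real.log 16) ≤ Real.log (Real.log (max (rad a b c : ℝ) 16)) :=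
      Real.log_le_log (by linarith) h1
    exact Real.log_le_log hll16 h2
  have hℓ0 : 0 < ℓ := lt_of_lt_of_le hℓ₀ hℓℓ₀
  have hℓu : ℓ ≤ u := log₃_le_log₂ hG6
  -- `E = L ℓ / u`, `T = exp E = G^{s(G)}`
  set E : ℝ := L * ℓ / u with hEdef
  have hE0 : 0 < E := by positivity
  have hEL : E ≤ L := by
    rw [hEdef, div_le_iff₀ hu0]
    exact mul_le_mul_of_nonneg_left hℓu hL0.le
  have hEℓ : ℓ₀ ≤ E := by
    rw [hEdef, le_div_iff₀ hu0]
    have : u ≤ L := by linarith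
    calc ℓ₀ * u ≤ ℓ * L := mul_le_mul hℓℓ₀ this hu0.le hℓ0.le
      _ = L * ℓ := mul_comm _ _
  have hexpE : ∀ C : ℝ, (rad a b c : ℝ) ^ thm2Exponent C (rad a b c) = Real.exp (C * E) := by
    intro C
    rw [Real.rpow_def_of_pos hG0, thm2Exponent_def]
    congr 1
    rw [hEdef]
    ring
  set T : ℝ := Real.exp E with hTdef
  have hT1 : 1 ≤ T := by rw [hTdef]; exact Real.one_le_exp hE0.le
  -- the per-triple bound
  obtain ⟨n, hTn, hmain⟩ :=
    log_le_pmin_mul_grouped hK hpad hpadc Cw hCw hW₂ Cb hCb1 hCbmono hCwCb h hab hc2 hT1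
  set Y : ℝ := Real.log (max (Real.exp 1) (2 * Real.log c)) with hYdef
  set ω : ℕ := (a * b * c).primeFactors.card with hωdef
  set PL : ℝ := ∏ q ∈ (a * b * c).primeFactors, Real.log ((max 4 q : ℕ) : ℝ) with hPLdef
  set M : ℝ := K ^ (ω + 1) * PL with hMdef
  have hΛL : max 1 (Real.log ((rad a b c : ℕ) : ℝ)) = L := by rw [hLdef]; exact max_eq_right hL1.le
  rw [hΛL] at hmain
  set Q : ℝ := (ω : ℝ) * M * T * L with hQdef
  set A : ℝ := 700 * Cb (n + 1) * 2 ^ (n + 2) * L ^ n * Q ^ 3 with hAdef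
  have hmain' : Real.log c ≤ (pmin a b c : ℝ) * A * Y ^ 2 := hmain
  -- sizes: `ω, M ≥ 1`
  have hPL1 : 1 ≤ PL := one_le_prod_log_max_four _
  have hM1 : 1 ≤ M := one_le_mul_of_one_le_of_one_le (one_le_pow₀ hK) hPL1
  have hM0 : 0 < M := by linarith
  have hω1 : (1 : ℝ) ≤ ω := by
    have h1' : 1 < a * b * c := by
      have hab1 : 1 ≤ a * b := Nat.mul_pos ha hb
      calc 1 < c := by omega
        _ ≤ a * b * c := Nat.le_mul_of_pos_left c hab1
    exact_mod_cast Finset.card_pos.mpr (Nat.nonempty_primeFactors.mpr h1')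
  have hω0 : (0 : ℝ) < ω := by linarith
  -- `absorb`: `128 M² ω² L ≤ exp(Cabs E)`, hence `ω, M, L ≤ exp(Cabs E)`
  have hprod : ((rad a b c : ℕ) : ℝ) = ∏ q ∈ (a * b * c).primeFactors, (q : ℝ) := by
    rw [rad_def, Nat.radical_eq_prod_primeFactors]; push_cast; rfl
  have habs' : 128 * M ^ 2 * (ω : ℝ) ^ 2 * L ≤ Real.exp (Cabs * E) := by
    have h6 : (6 : ℝ) ≤ ∏ q ∈ (a * b * c).primeFactors, (q : ℝ) := by rw [← hprod]; exact hG6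
    have hQ := habs _ (fun q hq => Nat.prime_of_mem_primeFactors hq) h6
    rw [← hprod, hexpE] at hQ
    exact hQ
  have hM2 : 1 ≤ M ^ 2 := one_le_pow₀ hM1
  have hω2 : (1 : ℝ) ≤ (ω : ℝ) ^ 2 := one_le_pow₀ hω1
  have h128 : (1 : ℝ) ≤ 128 * M ^ 2 * (ω : ℝ) ^ 2 := by
    have := one_le_mul_of_one_le_of_one_le hM2 hω2
    nlinarith only [this]
  have h1280 : (0 : ℝ) ≤ 128 * M ^ 2 * (ω : ℝ) ^ 2 := zero_le_one.trans h128
  have hωE : (ω : ℝ) ≤ Real.exp (Cabs * E) := by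
    refine le_trans ?_ habs'
    calc (ω : ℝ) ≤ (ω : ℝ) ^ 2 := le_self_pow₀ hω1 (by norm_num)
      _ = 1 * (ω : ℝ) ^ 2 * 1 := by ring
      _ ≤ 128 * M ^ 2 * (ω : ℝ) ^ 2 * L := by
          apply mul_le_mul _ hL1.le zero_le_one h1280
          exact mul_le_mul_of_nonneg_right (by nlinarith only [hM2]) (by positivity)
  have hME : M ≤ Real.exp (Cabs * E) := by
    refine le_trans ?_ habs'
    calc M ≤ M ^ 2 := le_self_pow₀ hM1 (by norm_num)
      _ = 128 * M ^ 2 * (1 / 128) * 1 := by ring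
      _ ≤ 128 * M ^ 2 * (ω : ℝ) ^ 2 * L := by
          apply mul_le_mul _ hL1.le zero_le_one h1280
          exact mul_le_mul_of_nonneg_left (le_trans (by norm_num) hω2) (by positivity)
  have hLE : L ≤ Real.exp (Cabs * E) := by
    refine le_trans ?_ habs'
    calc L = 1 * L := (one_mul L).symm
      _ ≤ 128 * M ^ 2 * (ω : ℝ) ^ 2 * L := mul_le_mul_of_nonneg_right h128 hL0.le
  -- `Q ≤ exp((3 Cabs + 1) E)`
  have hexp0 : ∀ t : ℝ, 0 ≤ Real.exp t := fun t => (Real.exp_pos t).le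
  have hQE : Q ≤ Real.exp ((3 * Cabs + 1) * E) := by
    have h1 : (ω : ℝ) * M ≤ Real.exp (Cabs * E) * Real.exp (Cabs * E) :=
      mul_le_mul hωE hME hM0.le (hexp0 _)
    have h2 : (ω : ℝ) * M * T ≤ Real.exp (Cabs * E) * Real.exp (Cabs * E) * Real.exp E :=
      mul_le_mul h1 le_rfl (hexp0 _) (mul_nonneg (hexp0 _) (hexp0 _))
    have h3 : (ω : ℝ) * M * T * L ≤
        Real.exp (Cabs * E) * Real.exp (Cabs * E) * Real.exp E * Real.exp (Cabs * E) :=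
      mul_le_mul h2 hLE hL0.le (mul_nonneg (mul_nonneg (hexp0 _) (hexp0 _)) (hexp0 _))
    have h4 : Real.exp (Cabs * E) * Real.exp (Cabs * E) * Real.exp E * Real.exp (Cabs * E) =
        Real.exp ((3 * Cabs + 1) * E) := by
      rw [← Real.exp_add, ← Real.exp_add, ← Real.exp_add]; ring_nf
    rw [hQdef, ← h4]; exact h3
  have hQ0 : 0 ≤ Q := by
    rw [hQdef]; exact mul_nonneg (mul_nonneg (mul_nonneg hω0.le hM0.le) (by linarith)) hL0.le
  have hQ3E : Q ^ 3 ≤ Real.exp (3 * ((3 * Cabs + 1) * E)) := by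
    calc Q ^ 3 ≤ Real.exp ((3 * Cabs + 1) * E) ^ 3 := pow_le_pow_left₀ hQ0 hQE 3
      _ = Real.exp (3 * ((3 * Cabs + 1) * E)) := by rw [← Real.exp_nat_mul]; norm_num
  -- `n ≤ ν = u/ℓ`, `ν ≥ 1`
  have hnE : (n : ℝ) * E ≤ L := by
    have h1 : Real.log (T ^ n) ≤ Real.log (rad a b c : ℝ) :=
      Real.log_le_log (pow_pos (Real.exp_pos E) n) hTn
    rwa [Real.log_pow, hTdef, Real.log_exp] at h1
  set ν : ℝ := u / ℓ with hνdef
  have hν1 : 1 ≤ ν := by rw [hνdef, le_div_iff₀ hℓ0, one_mul]; exact hℓu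
  have hν0 : 0 ≤ ν := zero_le_one.trans hν1
  have hnν : (n : ℝ) ≤ ν := by
    rw [hνdef, le_div_iff₀ hℓ0]
    have h1 : (n : ℝ) * (L * ℓ) ≤ L * u := by
      have h2 := hnE
      rw [hEdef, ← mul_div_assoc, div_le_iff₀ hu0] at h2
      exact h2
    have h2 : L * ((n : ℝ) * ℓ) ≤ L * u := by linarith only [h1]
    exact le_of_mul_le_mul_left h2 hL0
  -- unit inequalities: `u² ≤ 4L`, `u³ ≤ 27 L`
  have hu2 : u ^ 2 ≤ 4 * L := by
    have h1 := Real.log_le_rpow_div hL0.le (by norm_num : (0 : ℝ) < 1 / 2)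
    have h2 : u ≤ 2 * L ^ (1 / 2 : ℝ) := by rw [hudef]; linarith only [h1]
    have h3 : (L ^ (1 / 2 : ℝ)) ^ 2 = L := by
      rw [← Real.rpow_natCast, ← Real.rpow_mul hL0.le]; norm_num
    calc u ^ 2 ≤ (2 * L ^ (1 / 2 : ℝ)) ^ 2 := pow_le_pow_left₀ hu0.le h2 2
      _ = 4 * L := by rw [mul_pow, h3]; norm_num
  have hu3 : u ^ 3 ≤ 27 * L := by
    have h1 := Real.log_le_rpow_div hL0.le (by norm_num : (0 : ℝ) < 1 / 3)
    have h2 : u ≤ 3 * L ^ (1 / 3 : ℝ) := by rw [hudef]; linarith only [h1]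
    have h3 : (L ^ (1 / 3 : ℝ)) ^ 3 = L := by
      rw [← Real.rpow_natCast, ← Real.rpow_mul hL0.le]; norm_num
    calc u ^ 3 ≤ (3 * L ^ (1 / 3 : ℝ)) ^ 3 := pow_le_pow_left₀ hu0.le h2 3
      _ = 27 * L := by rw [mul_pow, h3]; norm_num
  -- `u ≤ κ₁ E`, `ν u ≤ κ₂ E`, `ν² ≤ κ₃ E`, `t ≤ (t/ℓ₀) E`
  have hℓ2 : ℓ₀ ^ 2 ≤ ℓ ^ 2 := pow_le_pow_left₀ hℓ₀.le hℓℓ₀ 2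
  have hℓ3 : ℓ₀ ^ 3 ≤ ℓ ^ 3 := pow_le_pow_left₀ hℓ₀.le hℓℓ₀ 3
  have hU1 : u ≤ κ₁ * E := by
    have hkey : u * (ℓ₀ * u) ≤ 4 * L * ℓ := by
      calc u * (ℓ₀ * u) = ℓ₀ * u ^ 2 := by ring
        _ ≤ ℓ₀ * (4 * L) := mul_le_mul_of_nonneg_left hu2 hℓ₀.le
        _ ≤ ℓ * (4 * L) := mul_le_mul_of_nonneg_right hℓℓ₀ (by positivity)
        _ = 4 * L * ℓ := by ring
    have heq : κ₁ * E = (4 * L * ℓ) / (ℓ₀ * u) := by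
      rw [hκ₁, hEdef]; field_simp
    rw [heq, le_div_iff₀ (by positivity)]
    exact hkey
  have hU2 : ν * u ≤ κ₂ * E := by
    have hkey : u ^ 2 * (ℓ₀ ^ 2 * u) ≤ 27 * L * ℓ * ℓ := by
      calc u ^ 2 * (ℓ₀ ^ 2 * u) = ℓ₀ ^ 2 * u ^ 3 := by ring
        _ ≤ ℓ₀ ^ 2 * (27 * L) := mul_le_mul_of_nonneg_left hu3 (by positivity)
        _ ≤ ℓ ^ 2 * (27 * L) := mul_le_mul_of_nonneg_right hℓ2 (by positivity)
        _ = 27 * L * ℓ * ℓ := by ring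
    have heq1 : ν * u = u ^ 2 / ℓ := by rw [hνdef]; field_simp
    have heq2 : κ₂ * E = (27 * L * ℓ) / (ℓ₀ ^ 2 * u) := by
      rw [hκ₂, hEdef]; field_simp
    rw [heq1, heq2, div_le_div_iff₀ hℓ0 (by positivity)]
    exact hkey
  have hU3 : ν ^ 2 ≤ κ₃ * E := by
    have hkey : u ^ 2 * (ℓ₀ ^ 3 * u) ≤ 27 * L * ℓ * ℓ ^ 2 := by
      calc u ^ 2 * (ℓ₀ ^ 3 * u) = ℓ₀ ^ 3 * u ^ 3 := by ring
        _ ≤ ℓ₀ ^ 3 * (27 * L) := mul_le_mul_of_nonneg_left hu3 (by positivity)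
        _ ≤ ℓ ^ 3 * (27 * L) := mul_le_mul_of_nonneg_right hℓ3 (by positivity)
        _ = 27 * L * ℓ * ℓ ^ 2 := by ring
    have heq1 : ν ^ 2 = u ^ 2 / ℓ ^ 2 := by rw [hνdef, div_pow]
    have heq2 : κ₃ * E = (27 * L * ℓ) / (ℓ₀ ^ 3 * u) := by
      rw [hκ₃, hEdef]; field_simp
    rw [heq1, heq2, div_le_div_iff₀ (by positivity) (by positivity)]
    exact hkey
  have hU0 : ∀ {t : ℝ}, 0 ≤ t → t ≤ t / ℓ₀ * E := by
    intro t ht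
    rw [div_mul_eq_mul_div, le_div_iff₀ hℓ₀]
    exact mul_le_mul_of_nonneg_left hEℓ ht
  -- the factors of `A`
  have hx_exp : ∀ t : ℝ, t ≤ Real.exp t := fun t => by linarith [Real.add_one_le_exp t]
  have h700 : (700 : ℝ) ≤ Real.exp 7 := by
    have h1 : Real.exp 7 = Real.exp 1 ^ 7 := by rw [← Real.exp_nat_mul]; norm_num
    have h2 : (2.7 : ℝ) < Real.exp 1 := by have := Real.exp_one_gt_d9; linarith
    have h3 : (2.7 : ℝ) ^ 7 < Real.exp 1 ^ 7 := pow_lt_pow_left₀ h2 (by norm_num) (by norm_num)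
    have h4 : (700 : ℝ) ≤ 2.7 ^ 7 := by norm_num
    rw [h1]; linarith only [h3, h4]
  have hCbE : Cb (n + 1) ≤ Real.exp (4 * c₁ * ν ^ 2) := by
    have hm : (0 : ℝ) ≤ c₁ * ((n + 1 : ℕ) : ℝ) := by positivity
    have h1 : (c₁ * ((n + 1 : ℕ) : ℝ)) ^ (n + 1) ≤ Real.exp (c₁ * ((n + 1 : ℕ) : ℝ)) ^ (n + 1) :=
      pow_le_pow_left₀ hm (hx_exp _) _
    have h2 : Real.exp (c₁ * ((n + 1 : ℕ) : ℝ)) ^ (n + 1) =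
        Real.exp (((n + 1 : ℕ) : ℝ) * (c₁ * ((n + 1 : ℕ) : ℝ))) := by
      rw [← Real.exp_nat_mul]
    have h3 : ((n + 1 : ℕ) : ℝ) * (c₁ * ((n + 1 : ℕ) : ℝ)) ≤ 4 * c₁ * ν ^ 2 := by
      have hn1 : ((n + 1 : ℕ) : ℝ) ≤ 2 * ν := by push_cast; linarith only [hnν, hν1]
      have hn0 : (0 : ℝ) ≤ ((n + 1 : ℕ) : ℝ) := Nat.cast_nonneg _
      calc ((n + 1 : ℕ) : ℝ) * (c₁ * ((n + 1 : ℕ) : ℝ))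
          = c₁ * (((n + 1 : ℕ) : ℝ) * ((n + 1 : ℕ) : ℝ)) := by ring
        _ ≤ c₁ * ((2 * ν) * (2 * ν)) :=
            mul_le_mul_of_nonneg_left (mul_le_mul hn1 hn1 hn0 (by positivity)) hc₁0
        _ = 4 * c₁ * ν ^ 2 := by ring
    calc Cb (n + 1) = (c₁ * ((n + 1 : ℕ) : ℝ)) ^ (n + 1) := rfl
      _ ≤ Real.exp (((n + 1 : ℕ) : ℝ) * (c₁ * ((n + 1 : ℕ) : ℝ))) := by rw [← h2]; exact h1
      _ ≤ Real.exp (4 * c₁ * ν ^ 2) := Real.exp_le_exp.mpr h3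
  have h2E : (2 : ℝ) ^ (n + 2) ≤ Real.exp (3 * ν ^ 2) := by
    have he2 : (2 : ℝ) ≤ Real.exp 1 := by have := Real.exp_one_gt_d9; linarith
    have h1 : (2 : ℝ) ^ (n + 2) ≤ Real.exp 1 ^ (n + 2) := pow_le_pow_left₀ (by norm_num) he2 _
    have h2 : Real.exp 1 ^ (n + 2) = Real.exp (((n + 2 : ℕ) : ℝ) * 1) := by rw [← Real.exp_nat_mul]
    have h3 : ((n + 2 : ℕ) : ℝ) * 1 ≤ 3 * ν ^ 2 := by
      push_cast
      have : ν ≤ ν ^ 2 := by nlinarith only [hν1]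
      linarith only [hnν, hν1, this]
    calc (2 : ℝ) ^ (n + 2) ≤ Real.exp (((n + 2 : ℕ) : ℝ) * 1) := by rw [← h2]; exact h1
      _ ≤ Real.exp (3 * ν ^ 2) := Real.exp_le_exp.mpr h3
  have hLexp : L = Real.exp u := by rw [hudef, Real.exp_log hL0]
  have hLn : L ^ n ≤ Real.exp (ν * u) := by
    have h2 : L ^ n = Real.exp ((n : ℝ) * u) := by rw [hLexp, ← Real.exp_nat_mul]
    rw [h2]
    exact Real.exp_le_exp.mpr (mul_le_mul_of_nonneg_right hnν hu0.le)
  -- `A ≤ exp(CA E)`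
  have hAexp : A ≤ Real.exp (CA * E) := by
    have h1 : (700 : ℝ) * Cb (n + 1) ≤ Real.exp 7 * Real.exp (4 * c₁ * ν ^ 2) :=
      mul_le_mul h700 hCbE (zero_le_one.trans (hCb1 _)) (hexp0 _)
    have h2 : (700 : ℝ) * Cb (n + 1) * 2 ^ (n + 2) ≤
        Real.exp 7 * Real.exp (4 * c₁ * ν ^ 2) * Real.exp (3 * ν ^ 2) :=
      mul_le_mul h1 h2E (by positivity) (mul_nonneg (hexp0 _) (hexp0 _))
    have h3 : (700 : ℝ) * Cb (n + 1) * 2 ^ (n + 2) * L ^ n ≤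
        Real.exp 7 * Real.exp (4 * c₁ * ν ^ 2) * Real.exp (3 * ν ^ 2) * Real.exp (ν * u) :=
      mul_le_mul h2 hLn (pow_nonneg hL0.le n)
        (mul_nonneg (mul_nonneg (hexp0 _) (hexp0 _)) (hexp0 _))
    have h4 : A ≤ Real.exp 7 * Real.exp (4 * c₁ * ν ^ 2) * Real.exp (3 * ν ^ 2) * Real.exp (ν * u) *
        Real.exp (3 * ((3 * Cabs + 1) * E)) := by
      rw [hAdef]
      exact mul_le_mul h3 hQ3E (pow_nonneg hQ0 3)
        (mul_nonneg (mul_nonneg (mul_nonneg (hexp0 _) (hexp0 _)) (hexp0 _)) (hexp0 _))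
    have h5 : Real.exp 7 * Real.exp (4 * c₁ * ν ^ 2) * Real.exp (3 * ν ^ 2) * Real.exp (ν * u) *
        Real.exp (3 * ((3 * Cabs + 1) * E)) =
        Real.exp (7 + 4 * c₁ * ν ^ 2 + 3 * ν ^ 2 + ν * u + 3 * ((3 * Cabs + 1) * E)) := by
      rw [← Real.exp_add, ← Real.exp_add, ← Real.exp_add, ← Real.exp_add]
    have h6 : 7 + 4 * c₁ * ν ^ 2 + 3 * ν ^ 2 + ν * u + 3 * ((3 * Cabs + 1) * E) ≤ CA * E := by
      have h7 : (7 : ℝ) ≤ 7 / ℓ₀ * E := hU0 (by norm_num)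
      have h8 : (4 * c₁ + 3) * ν ^ 2 ≤ (4 * c₁ + 3) * (κ₃ * E) :=
        mul_le_mul_of_nonneg_left hU3 (by positivity)
      have h9 : CA * E = 7 / ℓ₀ * E + (4 * c₁ + 3) * (κ₃ * E) + κ₂ * E + 9 * Cabs * E + 3 * E := by
        rw [hCAdef]; ring
      rw [h9]
      nlinarith only [h7, h8, hU2]
    calc A ≤ _ := h4
      _ = _ := h5
      _ ≤ Real.exp (CA * E) := Real.exp_le_exp.mpr h6
  -- `A ≥ 1`, `p′ ∈ [1, G]`
  have hQ1 : 1 ≤ Q := by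
    rw [hQdef]
    exact one_le_mul_of_one_le_of_one_le
      (one_le_mul_of_one_le_of_one_le (one_le_mul_of_one_le_of_one_le hω1 hM1) hT1) hL1.le
  have hA1 : 1 ≤ A := by
    rw [hAdef]
    have h1 : (1 : ℝ) ≤ 700 * Cb (n + 1) := by nlinarith only [hCb1 (n + 1)]
    have h2 : (1 : ℝ) ≤ 2 ^ (n + 2) := one_le_pow₀ (by norm_num)
    exact one_le_mul_of_one_le_of_one_le
      (one_le_mul_of_one_le_of_one_le (one_le_mul_of_one_le_of_one_le h1 h2) (one_le_pow₀ hL1.le))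
      (one_le_pow₀ hQ1)
  have hp1 : (1 : ℝ) ≤ pmin a b c := by exact_mod_cast one_le_pmin a b c
  have hp0 : (0 : ℝ) < pmin a b c := by linarith
  have hpG : (pmin a b c : ℝ) ≤ (rad a b c : ℝ) := by
    have hcne : c.primeFactors.Nonempty := Nat.nonempty_primeFactors.mpr (by omega)
    have hPc := largestPrimeFactor_mem hcne
    have hPc' : largestPrimeFactor c ≤ rad a b c :=
      prime_le_rad (Nat.prime_of_mem_primeFactors hPc)
        ((Nat.dvd_of_mem_primeFactors hPc).trans (Dvd.intro_left (a * b) rfl)) habc0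
    have h1 : pmin a b c ≤ largestPrimeFactor c := by
      rw [pmin_def]; exact (min_le_right _ _).trans (min_le_right _ _)
    exact_mod_cast h1.trans hPc'
  -- self-improvement
  have hA'1 : 1 ≤ (pmin a b c : ℝ) * A := one_le_mul_of_one_le_of_one_le hp1 hA1
  have hSI := le_sixteen_mul_log_sq_of_le hA'1 hmain'
  -- `log(2 p′ A) ≤ (2 + CA) L`
  have hlog2pA : Real.log (2 * ((pmin a b c : ℝ) * A)) ≤ (2 + CA) * L := by
    have h1 : 2 * ((pmin a b c : ℝ) * A) ≤ 2 * (pmin a b c : ℝ) * Real.exp (CA * E) := by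
      rw [mul_assoc]
      exact mul_le_mul_of_nonneg_left (mul_le_mul_of_nonneg_left hAexp hp0.le) (by norm_num)
    have h2 : Real.log (2 * ((pmin a b c : ℝ) * A)) ≤
        Real.log (2 * (pmin a b c : ℝ) * Real.exp (CA * E)) :=
      Real.log_le_log (mul_pos two_pos (mul_pos hp0 (by linarith only [hA1]))) h1
    have h3 : Real.log (2 * (pmin a b c : ℝ) * Real.exp (CA * E)) =
        Real.log 2 + Real.log (pmin a b c : ℝ) + CA * E := by
      rw [Real.log_mul (by positivity) (Real.exp_pos _).ne', Real.log_mul (by norm_num) hp0.ne',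
        Real.log_exp]
    have h4 : Real.log (pmin a b c : ℝ) ≤ L := Real.log_le_log hp0 hpG
    have h5 : Real.log 2 ≤ 1 := by have := Real.log_two_lt_d9; linarith
    have h6 : CA * E ≤ CA * L := mul_le_mul_of_nonneg_left hEL hCA0
    rw [h3] at h2
    nlinarith only [h2, h4, h5, h6, hL1]
  have hlog2pA0 : 0 ≤ Real.log (2 * ((pmin a b c : ℝ) * A)) := Real.log_nonneg (by linarith)
  have hsq : Real.log (2 * ((pmin a b c : ℝ) * A)) ^ 2 ≤ ((2 + CA) * L) ^ 2 :=
    pow_le_pow_left₀ hlog2pA0 hlog2pA 2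
  -- `16 (2+CA)² A L² ≤ exp(Ctot E)`
  have hL2 : L ^ 2 ≤ Real.exp (2 * κ₁ * E) := by
    rw [hLexp, ← Real.exp_nat_mul]
    push_cast
    exact Real.exp_le_exp.mpr (by linarith only [hU1])
  have hconst : 16 * (2 + CA) ^ 2 ≤ Real.exp (16 * (2 + CA) ^ 2 / ℓ₀ * E) :=
    (hx_exp _).trans (Real.exp_le_exp.mpr (hU0 (by positivity)))
  have hfinal : 16 * ((pmin a b c : ℝ) * A) * ((2 + CA) * L) ^ 2 ≤
      (pmin a b c : ℝ) * Real.exp (Ctot * E) := by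
    have h1 : 16 * (2 + CA) ^ 2 * A * L ^ 2 ≤
        Real.exp (16 * (2 + CA) ^ 2 / ℓ₀ * E) * Real.exp (CA * E) * Real.exp (2 * κ₁ * E) :=
      mul_le_mul (mul_le_mul hconst hAexp (zero_le_one.trans hA1) (hexp0 _)) hL2 (sq_nonneg _)
        (mul_nonneg (hexp0 _) (hexp0 _))
    have h2 : Real.exp (16 * (2 + CA) ^ 2 / ℓ₀ * E) * Real.exp (CA * E) * Real.exp (2 * κ₁ * E) =
        Real.exp (Ctot * E) := by
      rw [← Real.exp_add, ← Real.exp_add, hCtotdef]; ring_nf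
    calc 16 * ((pmin a b c : ℝ) * A) * ((2 + CA) * L) ^ 2
        = (pmin a b c : ℝ) * (16 * (2 + CA) ^ 2 * A * L ^ 2) := by ring
      _ ≤ (pmin a b c : ℝ) * (Real.exp (16 * (2 + CA) ^ 2 / ℓ₀ * E) * Real.exp (CA * E) *
            Real.exp (2 * κ₁ * E)) := mul_le_mul_of_nonneg_left h1 hp0.le
      _ = (pmin a b c : ℝ) * Real.exp (Ctot * E) := by rw [h2]
  have hlt : (pmin a b c : ℝ) * Real.exp (Ctot * E) < (pmin a b c : ℝ) * Real.exp ((Ctot + 1) * E) := by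
    apply mul_lt_mul_of_pos_left _ hp0
    exact Real.exp_lt_exp.mpr (by nlinarith only [hE0, hCtot0])
  rw [hexpE]
  calc Real.log c ≤ 16 * ((pmin a b c : ℝ) * A) * Real.log (2 * ((pmin a b c : ℝ) * A)) ^ 2 := hSI
    _ ≤ 16 * ((pmin a b c : ℝ) * A) * ((2 + CA) * L) ^ 2 :=
        mul_le_mul_of_nonneg_left hsq (mul_nonneg (by norm_num) (mul_nonneg hp0.le (zero_le_one.trans hA1)))
    _ ≤ (pmin a b c : ℝ) * Real.exp (Ctot * E) := hfinal
    _ < (pmin a b c : ℝ) * Real.exp ((Ctot + 1) * E) := hlt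

/-- **Stewart–Yu 2001, Theorem 2, from the two `p`-adic place bounds ALONE.**  For `K ≥ 1` and every abc triple:
(p ∣ a) `ν_p(a) log p < Θ_{bc} (p/log p)(log p + Y)` and (p ∣ c, `ab > 1`) `ν_p(c) log p < Θ_{ab} (p/log p)(log p + Y)`
— `p`-adic bounds for rational PRIMES of Yu-2007 quality — imply `stewartYu2001_thm2`
(`z < exp(p′ · G^{C log₃ G⋆ / log₂ G})`): the archimedean side of
`stewartYu2001_thm2_of_placeBounds_kummerArchBound₂` is the tree's THEOREM
`Literature.NumberTheory.Transcendental.Waldschmidt1980.waldschmidt1980_hW₂` (Waldschmidt 1980, Prop. 3.8 over `ℚ`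
under the `2`-Kummer condition) with its constant `w80Cw n = (2⁷⁰ n)ⁿ` (`w80Cw_le`).  Compare
`stewartYu2001_thm2_of_placeBounds` (`AbcStewartYu2001PlaceBoundsProofs.lean`), which needs in addition the many-logarithm
archimedean place bound `log c − log a < Θ_{bc} · Y`. [cite: StewartYu2001, Theorem 2]
[cite: Waldschmidt1980, Prop 3.8 (p. 274)] -/
theorem stewartYu2001_thm2_of_placeBounds₂ (hK : 1 ≤ K)
    (hpad : ∀ {a b c : ℕ}, IsABCTriple a b c → ∀ {p : ℕ}, p.Prime → p ∣ a →
      (a.factorization p : ℝ) * Real.log p < theta K b c 0 *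
        ((p / Real.log p) * (Real.log p + Real.log (max (Real.exp 1) (2 * Real.log c)))))
    (hpadc : ∀ {a b c : ℕ}, IsABCTriple a b c → 1 < a * b → ∀ {p : ℕ}, p.Prime → p ∣ c →
      (c.factorization p : ℝ) * Real.log p < theta K a b 0 *
        ((p / Real.log p) * (Real.log p + Real.log (max (Real.exp 1) (2 * Real.log c))))) :
    stewartYu2001_thm2 :=
  stewartYu2001_thm2_of_placeBounds_kummerArchBound₂ hK hpad hpadc
    Literature.NumberTheory.Transcendental.Waldschmidt1980.w80Cw
    Literature.NumberTheory.Transcendental.Waldschmidt1980.w80Cw_nonneg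
    ⟨2 ^ 70, fun n => Literature.NumberTheory.Transcendental.Waldschmidt1980.w80Cw_le n⟩
    Literature.NumberTheory.Transcendental.Waldschmidt1980.waldschmidt1980_hW₂

end Door

end StewartYu2001

end Literature.NumberTheory.DiophantineGeometry

end
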